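import Summits.Ventures.HodgeRepro2.T5SU11HardyRemainderResolvent

/-!
# The strict Hardy inequality on the range of the resolvent: equality forces `f ≡ 0`

Row 484 proved the ground-state identity `‖(G_λ f)′‖² − ‖G_λ f‖² = ∫_0^∞ sinh 2t ((G_λ f)′Ξ − (G_λ f)Ξ′)²/Ξ²` for
the resolvent `G_λ = (L − λ(λ−2))⁻¹`, `λ > 1`, applied to a continuous source `f` supported in `[a, b] ⊂ (0, ∞)`.
Here its EQUALITY CASE is settled:

* equality forces the (continuous, non-negative) remainder integrand to vanish on `(0, ∞)` (`remainder_eqOn_zero`),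
  i.e. `(u/Ξ)′ = 0` (`numerator_eq_zero`), so `u = G_λ f = c Ξ` on `(0, ∞)` (`exists_eq_mul_sph_one`);
* on `(0, a)` the source vanishes, so `u` solves the radial equation at `μ = λ(λ−2)` while `c Ξ` solves it at
  `μ = −1`: `(μ + 1) sinh 2t · u = 0` with `μ + 1 = (λ−1)² > 0`, hence `c = 0` and **`G_λ f ≡ 0`** on `(0, ∞)`
  (`sphGreen_eq_zero_of_hardy_eq`), and then **`f = (L − μ)(G_λ f) ≡ 0`** on `(0, ∞)` (`eq_zero_of_hardy_eq`);
* so for every source `f ≢ 0` the Hardy inequality on the range of the resolvent is STRICT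
  (`hardy_inequality_strict`) and the spectral-gap inequality of row 478 is strict:
  **`⟨f, G_λ f⟩ < −(λ−1)² ‖G_λ f‖²`** (`inner_sphGreen_lt`).

Nothing is claimed about (N).

Blind lane: Mathlib + the HodgeRepro2 prefix only; no sorry; axioms ⊆ {propext, Classical.choice,
Quot.sound}.
-/

namespace Summit.Ventures.HodgeRepro2.T5SU11HardyStrictResolvent

open Filter Topology MeasureTheory intervalIntegral
open Set (Ioi Ioo Ioc Ico Icc uIcc)
open T5SU11Cartan T5SU11SphericalFunction T5SU11SphericalBounds T5SU11SphericalContinuous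
  T5SU11SphericalSolutionSpaceAll T5SU11ReductionOfOrder T5SU11RadialGreen T5SU11SphericalGreen
  T5SU11ResolventTransform T5SU11ResolventEnergyPieces T5SU11ResolventEnergy T5SU11GroundStateTransform
  T5SU11HardyInequality T5SU11HardyRemainderResolvent

section measure

variable [MeasurableSpace Circle] [BorelSpace Circle]

variable {lam a b : ℝ} {f : ℝ → ℝ} (hlam : 1 < lam) (hf : ContinuousOn f (Ioi 0))
  (ha : 0 < a) (hab : a ≤ b) (hfa : ∀ s, s ≤ a → f s = 0) (hfb : ∀ s, b ≤ s → f s = 0)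

include hlam hf ha hab hfa hfb in
/-- **Equality in Hardy forces the remainder integrand to vanish on `(0, ∞)`.** -/
theorem remainder_eqOn_zero
    (heq : ∫ t in Ioi 0, Real.sinh (2 * t) * sphGreen lam f a b t ^ 2
      = ∫ t in Ioi 0, Real.sinh (2 * t) * sphGreen' lam f a b t ^ 2) :
    Set.EqOn (fun t => Real.sinh (2 * t) * (sphGreen' lam f a b t * sph 1 (hyp t)
      - sphGreen lam f a b t * deriv (fun t => sph 1 (hyp t)) t) ^ 2 / sph 1 (hyp t) ^ 2) 0 (Ioi 0) := by
  have h0 : ∫ t in Ioi 0, Real.sinh (2 * t) * (sphGreen' lam f a b t * sph 1 (hyp t)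
      - sphGreen lam f a b t * deriv (fun t => sph 1 (hyp t)) t) ^ 2 / sph 1 (hyp t) ^ 2 = 0 := by
    rw [← hardy_identity_resolvent hlam hf ha hab hfa hfb, heq, sub_self]
  have hnn : 0 ≤ᵐ[volume.restrict (Ioi 0)] (fun t => Real.sinh (2 * t) * (sphGreen' lam f a b t * sph 1 (hyp t)
      - sphGreen lam f a b t * deriv (fun t => sph 1 (hyp t)) t) ^ 2 / sph 1 (hyp t) ^ 2) :=
    ae_restrict_of_forall_mem measurableSet_Ioi (fun t ht => remainder_nonneg _ _ (le_of_lt ht))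
  have hae := (integral_eq_zero_iff_of_nonneg_ae hnn (integrableOn_remainder hlam hf ha hab hfa hfb)).mp h0
  exact Measure.eqOn_open_of_ae_eq hae isOpen_Ioi (continuousOn_remainder hlam hf ha hab) continuousOn_const

include hlam hf ha hab hfa hfb in
/-- **Equality in Hardy forces `(G_λ f)′Ξ − (G_λ f)Ξ′ = 0` on `(0, ∞)`.** -/
theorem numerator_eq_zero
    (heq : ∫ t in Ioi 0, Real.sinh (2 * t) * sphGreen lam f a b t ^ 2
      = ∫ t in Ioi 0, Real.sinh (2 * t) * sphGreen' lam f a b t ^ 2) {t : ℝ} (ht : 0 < t) :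
    sphGreen' lam f a b t * sph 1 (hyp t) - sphGreen lam f a b t * deriv (fun t => sph 1 (hyp t)) t = 0 := by
  have h := remainder_eqOn_zero hlam hf ha hab hfa hfb heq ht
  simp only [Pi.zero_apply] at h
  have hs : Real.sinh (2 * t) ≠ 0 := (sinh_two_mul_pos ht).ne'
  have hΞ : sph 1 (hyp t) ^ 2 ≠ 0 := pow_ne_zero 2 (sph_hyp_pos 1 t).ne'
  rcases div_eq_zero_iff.mp h with h1 | h1
  · rcases mul_eq_zero.mp h1 with h2 | h2
    · exact absurd h2 hs
    · exact pow_eq_zero_iff (by norm_num) |>.mp h2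
  · exact absurd h1 hΞ

include hlam hf ha hab hfa hfb in
/-- **Equality in Hardy forces `G_λ f = c Ξ` on `(0, ∞)`.** -/
theorem exists_eq_mul_sph_one
    (heq : ∫ t in Ioi 0, Real.sinh (2 * t) * sphGreen lam f a b t ^ 2
      = ∫ t in Ioi 0, Real.sinh (2 * t) * sphGreen' lam f a b t ^ 2) :
    ∃ c : ℝ, ∀ t, 0 < t → sphGreen lam f a b t = c * sph 1 (hyp t) := by
  -- `w = G_λ f / Ξ` has derivative `0` on `(0, ∞)`
  have hw : ∀ t, 0 < t → HasDerivAt (fun t => sphGreen lam f a b t / sph 1 (hyp t)) 0 t := by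
    intro t ht
    have hd := (hasDerivAt_sphGreen hlam hf ha hab ht).div (hasDerivAt_sph_hyp_deriv 1 t) (sph_hyp_pos 1 t).ne'
    rwa [numerator_eq_zero hlam hf ha hab hfa hfb heq ht, zero_div] at hd
  refine ⟨sphGreen lam f a b a / sph 1 (hyp a), fun t ht => ?_⟩
  -- `w` is constant on `[min t a, max t a]`
  have hconst : ∀ c d, 0 < c → c ≤ d →
      sphGreen lam f a b d / sph 1 (hyp d) = sphGreen lam f a b c / sph 1 (hyp c) := by
    intro c d hc hcd
    have hcont : ContinuousOn (fun t => sphGreen lam f a b t / sph 1 (hyp t)) (Icc c d) :=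
      fun x hx => (hw x (lt_of_lt_of_le hc hx.1)).continuousAt.continuousWithinAt
    exact constant_of_has_deriv_right_zero hcont
      (fun x hx => (hw x (lt_of_lt_of_le hc hx.1)).hasDerivWithinAt) d ⟨hcd, le_rfl⟩
  have hΞ : sph 1 (hyp t) ≠ 0 := (sph_hyp_pos 1 t).ne'
  have h : sphGreen lam f a b t / sph 1 (hyp t) = sphGreen lam f a b a / sph 1 (hyp a) := by
    rcases le_total t a with hta | hat
    · exact (hconst t a ht hta).symm
    · exact hconst a t ha hat
  exact (div_eq_iff hΞ).mp h

include hlam hf ha hab hfa hfb in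
/-- **THE EQUALITY CASE ON THE RANGE OF THE RESOLVENT**: `‖G_λ f‖² = ‖(G_λ f)′‖²` forces `G_λ f ≡ 0` on
`(0, ∞)` (on `(0, a)` the source vanishes, and `Ξ` solves the radial equation at `−1 ≠ λ(λ−2)`). -/
theorem sphGreen_eq_zero_of_hardy_eq
    (heq : ∫ t in Ioi 0, Real.sinh (2 * t) * sphGreen lam f a b t ^ 2
      = ∫ t in Ioi 0, Real.sinh (2 * t) * sphGreen' lam f a b t ^ 2) {t : ℝ} (ht : 0 < t) :
    sphGreen lam f a b t = 0 := by
  obtain ⟨c, hc⟩ := exists_eq_mul_sph_one hlam hf ha hab hfa hfb heq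
  -- `c = 0`: compare the two equations at `t₀ = a/2`
  have hc0 : c = 0 := by
    set t₀ := a / 2 with ht₀
    have ht₀pos : 0 < t₀ := by rw [ht₀]; linarith
    have ht₀a : t₀ ≤ a := by rw [ht₀]; linarith
    have hev : (fun t => sphGreen lam f a b t) =ᶠ[𝓝 t₀] (fun t => c * sph 1 (hyp t)) :=
      eventuallyEq_of_mem (Ioi_mem_nhds ht₀pos) (fun s hs => hc s hs)
    -- `u′ = c Ξ′` and `u″ = c Ξ″` on a neighbourhood of `t₀`
    have hd1 : ∀ s, 0 < s → sphGreen' lam f a b s = c * deriv (fun t => sph 1 (hyp t)) s := by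
      intro s hs
      have hev' : (fun t => sphGreen lam f a b t) =ᶠ[𝓝 s] (fun t => c * sph 1 (hyp t)) :=
        eventuallyEq_of_mem (Ioi_mem_nhds hs) (fun x hx => hc x hx)
      exact (hasDerivAt_sphGreen hlam hf ha hab hs).unique
        (((hasDerivAt_sph_hyp_deriv 1 s).const_mul c).congr_of_eventuallyEq hev')
    have hev1 : (fun t => sphGreen' lam f a b t) =ᶠ[𝓝 t₀] (fun t => c * deriv (fun t => sph 1 (hyp t)) t) :=
      eventuallyEq_of_mem (Ioi_mem_nhds ht₀pos) (fun s hs => hd1 s hs)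
    have hd2 : sphGreen'' lam f a b t₀ = c * deriv (deriv fun t => sph 1 (hyp t)) t₀ :=
      (hasDerivAt_sphGreen' hlam hf ha hab ht₀pos).unique
        (((hasDerivAt_deriv_sph_hyp 1 t₀).const_mul c).congr_of_eventuallyEq hev1)
    have hode := sphGreen_ode hlam (f := f) (a := a) (b := b) ht₀pos
    have hΞode := sph_hyp_ode_deriv 1 t₀
    rw [hfa t₀ ht₀a, mul_zero, add_zero, hd2, hd1 t₀ ht₀pos, hc t₀ ht₀pos] at hode
    have hkey : ((lam - 1) ^ 2) * (Real.sinh (2 * t₀) * (c * sph 1 (hyp t₀))) = 0 := by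
      linear_combination c * hΞode - hode
    have hpos : 0 < Real.sinh (2 * t₀) * sph 1 (hyp t₀) :=
      mul_pos (sinh_two_mul_pos ht₀pos) (sph_hyp_pos 1 t₀)
    have hsq : (lam - 1) ^ 2 ≠ 0 := pow_ne_zero 2 (by linarith)
    rcases mul_eq_zero.mp hkey with h | h
    · exact absurd h hsq
    · rcases mul_eq_zero.mp h with h | h
      · exact absurd h (sinh_two_mul_pos ht₀pos).ne'
      · rcases mul_eq_zero.mp h with h | h
        · exact h
        · exact absurd h (sph_hyp_pos 1 t₀).ne'
  rw [hc t ht, hc0, zero_mul]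

include hlam hf ha hab hfa hfb in
/-- **Equality in Hardy forces the source to vanish**: `f = (L − λ(λ−2))(G_λ f) ≡ 0` on `(0, ∞)`. -/
theorem eq_zero_of_hardy_eq
    (heq : ∫ t in Ioi 0, Real.sinh (2 * t) * sphGreen lam f a b t ^ 2
      = ∫ t in Ioi 0, Real.sinh (2 * t) * sphGreen' lam f a b t ^ 2) {t : ℝ} (ht : 0 < t) : f t = 0 := by
  have hu : ∀ s, 0 < s → sphGreen lam f a b s = 0 := fun s hs =>
    sphGreen_eq_zero_of_hardy_eq hlam hf ha hab hfa hfb heq hs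
  have hu' : ∀ s, 0 < s → sphGreen' lam f a b s = 0 := by
    intro s hs
    have hev : (fun t => sphGreen lam f a b t) =ᶠ[𝓝 s] (fun _ => (0 : ℝ)) :=
      eventuallyEq_of_mem (Ioi_mem_nhds hs) (fun x hx => hu x hx)
    exact (hasDerivAt_sphGreen hlam hf ha hab hs).unique ((hasDerivAt_const s (0 : ℝ)).congr_of_eventuallyEq hev)
  have hu'' : sphGreen'' lam f a b t = 0 := by
    have hev : (fun t => sphGreen' lam f a b t) =ᶠ[𝓝 t] (fun _ => (0 : ℝ)) :=
      eventuallyEq_of_mem (Ioi_mem_nhds ht) (fun x hx => hu' x hx)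
    exact (hasDerivAt_sphGreen' hlam hf ha hab ht).unique ((hasDerivAt_const t (0 : ℝ)).congr_of_eventuallyEq hev)
  have hode := sphGreen_ode hlam (f := f) (a := a) (b := b) ht
  rw [hu t ht, hu' t ht, hu''] at hode
  have hs : Real.sinh (2 * t) ≠ 0 := (sinh_two_mul_pos ht).ne'
  have : Real.sinh (2 * t) * f t = 0 := by linear_combination -hode
  rcases mul_eq_zero.mp this with h | h
  · exact absurd h hs
  · exact h

include hlam hf ha hab hfa hfb in
/-- **THE STRICT HARDY INEQUALITY ON THE RANGE OF THE RESOLVENT**: `‖G_λ f‖² < ‖(G_λ f)′‖²` for every source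
`f ≢ 0` on `(0, ∞)`. -/
theorem hardy_inequality_strict (hne : ∃ t, 0 < t ∧ f t ≠ 0) :
    ∫ t in Ioi 0, Real.sinh (2 * t) * sphGreen lam f a b t ^ 2
      < ∫ t in Ioi 0, Real.sinh (2 * t) * sphGreen' lam f a b t ^ 2 := by
  refine lt_of_le_of_ne (hardy_inequality hlam hf ha hab hfa hfb) (fun heq => ?_)
  obtain ⟨t, ht, hft⟩ := hne
  exact hft (eq_zero_of_hardy_eq hlam hf ha hab hfa hfb heq ht)

include hlam hf ha hab hfa hfb in
/-- **The strict spectral gap on the range of the resolvent**: `⟨f, G_λ f⟩ < −(λ−1)² ‖G_λ f‖²` for every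
source `f ≢ 0` on `(0, ∞)`, `λ > 1`. -/
theorem inner_sphGreen_lt (hne : ∃ t, 0 < t ∧ f t ≠ 0) :
    ∫ t in a..b, f t * sphGreen lam f a b t * Real.sinh (2 * t)
      < -((lam - 1) ^ 2 * ∫ t in Ioi 0, Real.sinh (2 * t) * sphGreen lam f a b t ^ 2) := by
  have hE := energy_identity hlam hf ha hab hfa hfb
  have hH := hardy_inequality_strict hlam hf ha hab hfa hfb hne
  have heq : ∫ t in a..b, f t * sphGreen lam f a b t * Real.sinh (2 * t)
      = ∫ t in a..b, Real.sinh (2 * t) * (f t * sphGreen lam f a b t) :=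
    integral_congr (fun t _ => by ring)
  have hsq : (lam - 1) ^ 2 = 1 + lam * (lam - 2) := by ring
  rw [heq, hsq]
  linarith

end measure

end Summit.Ventures.HodgeRepro2.T5SU11HardyStrictResolvent
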